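import Summits.BirchSwinnertonDyer.BirchSwinnertonDyer.Theorems.KatoDescentPotSupersingularWildUpperReducibleNineTorsionRecords
import Summits.BirchSwinnertonDyer.Rank1Residual.Supersingular.RationalLadder
import Literature.NumberTheory.EllipticCurves.MazurTorsionOrderValuationProofs
import HarnessLib

/-!
# Route `KatoDescentPotSupersingular` (rung K9, cell `bsd-potss`): the `ℤ/9` CLASSES of the crux
# `WildUpperReducibleDefect` (item stmt-BirchSwinnertonDyer-19190, registered stub `stub_red_nineTorsionMember`)
# — the stub's `ℤ/9`-MEMBER HYPOTHESIS WITNESSED IN THE KERNEL on all nine census curves: rational points of exact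
# order `9` on `54b3`, `1890r3`, `122094bl3` (a `--supports 19190 --as helper` file; seat `bsd-potss-k9-red9` g3;
# nothing booked, BSD is not proved by any of this, item 19190 is NOT closed by this file)

WHERE THIS SITS.  Fourth file of this seat's `ℤ/9`-classes series (`…NineTorsionClasses` p464900, `…NineTorsionIsogenies`
p470874, `…NineTorsionRecords`).  The registered stub `Sig.stub_red_nineTorsionMember` quantifies over the rows `W`
(globally minimal, `r_an = 0`, `ClassO6 W 3`, `E[3]` reducible) whose isogeny class contains SOME `W'` with
`3² ∣ #W'(ℚ)_tors`.  So far the membership of the three census classes in that scope was Cremona's table datum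
«`t = 9`» at `54b3`, `1890r3`, `122094bl3`.  THIS FILE makes it a kernel fact:

* §1 `nine_dvd_torsionOrder_54b3 / _1890r3 / _122094bl3`: an explicit integral point `P` of EXACT order `9` on each
  `ℤ/9` member — `P = (-3, -5)` on `54b3`, `(117, -1109)` on `1890r3`, `(8139, -16838)` on `122094bl3` — by the
  tree's division-free double-and-add LADDER over `ℚ` (`Supersingular.nsmul_some_eq_of_ladderRunQ`, x10b gen 16):
  three certified doublings give `8·P = -P` (all slopes integral: `-2, 4, 1`; `-50, 70, 34`; `-224, 280, 175`), hence
  `9·P = O`, and one double-and-add gives `3·P = (1,-5)`, `(217,-4109)`, `(8587,-92102) ≠ O`; so `addOrderOf P = 9`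
  (`addOrderOf_eq_prime_pow`) and `9 ∣ #E(ℚ)_tors` by Lagrange (`addOrderOf_dvd_torsionOrder`).  (Mazur / Cremona:
  `#E(ℚ)_tors = 9` exactly; the divisibility is what the stub's hypothesis asks.)
* §2 `nineTorsionMember_census`: for EACH of the nine literal census curves `W`, the stub's hypothesis
  `∃ W' (_ : W'.IsElliptic), W ∼_ℚ W' ∧ 3² ∣ #W'(ℚ)_tors` — from §1 and the kernel isogenies of `…NineTorsionIsogenies`
  (`isIsogenous_54b1_54b3`, …, `isIsogenous_nine`).  Together with the records v2 this puts every datum of the three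
  classes that the route's U₀-red defect analysis uses (class graph, `ℤ/9` member, conductor `< 5000` for bsd.S31) in
  the kernel, except the `L`-value binders `hr`/`hs` and the `3`-descent certificate `hSha` of `122094bl1`.

HONEST FRAMING.  Kernel facts about explicit curves; census-level only (that these three classes are ALL the X3 ∧ O6 ∧
r0 classes with a `ℤ/9` member below `5·10⁵` is the C-X3K-0 census statement, not a theorem here); class-wide the stub
is the count fact's road and the item stays settled-by-citation via glue 19711; in the KT twin the `ℤ/9` disjunct is
VOID granted Ogg–Saito (`…TameUpperReducibleTorsionVoid`), here it is INHABITED; typed ≠ proved ≠ endorsed; nothing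
booked.  THEOREMS ONLY (no definition, no new fact, no `sorry`).  Certificates: seat folder `census/torsion9.py`.

References: [SilvermanAEC2009] III.2.3 (group law), VII.3.4 (Nagell–Lutz: torsion points are integral), VIII.7;
[CremonaAlgorithms1997] §3.3; [Cremona2006] Table 1 (54b3, 1890r3, 122094bl3: `#E(ℚ)_tors = 9`); [Mazur1977] Thm. 8.
-/

set_option autoImplicit false
-- sibling precedent (`KatoDescentPotSupersingularAssembly.lean`): the directory name repeats the summit name
set_option linter.dupNamespace false

noncomputable section

open scoped Classical

namespace Summit.BirchSwinnertonDyer.BirchSwinnertonDyer.Theorems.WildUpperReducibleNineTorsionWitnesses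

open WeierstrassCurve Literature.NumberTheory.EllipticCurves
  Summit.BirchSwinnertonDyer.Rank1Residual.Supersingular
  Summit.BirchSwinnertonDyer.BirchSwinnertonDyer.Theorems.WildUpperReducibleNineTorsionClasses
  Summit.BirchSwinnertonDyer.BirchSwinnertonDyer.Theorems.WildUpperReducibleNineTorsionIsogenies
  Summit.BirchSwinnertonDyer.BirchSwinnertonDyer.Theorems.WildUpperReducibleNineTorsionRecords

/-! ## §1 Rational points of exact order `9` on the three `ℤ/9` members -/

/-- **From a ladder certificate to `9 ∣ #E(ℚ)_tors`.** On any `W/ℚ`: a rational affine point `P = (x₀, y₀)` with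
`8·P = (x₀, y₈)`, `y₈ = -y₀ - a₁x₀ - a₃` (so `8·P = -P`, `9·P = O`) and `3·P` affine (so `3·P ≠ O`) has
`addOrderOf P = 9`, and `9 ∣ #E(ℚ)_tors` by Lagrange in the finite group `E(ℚ)_tors`.
[cite: SilvermanAEC2009, III.2.3 and VIII.7] -/
theorem nine_dvd_torsionOrder_of_multiples (W : WeierstrassCurve ℚ) [W.IsElliptic] {x₀ y₀ y₈ x₃ y₃ : ℚ}
    (h₀ : W.toAffine.Nonsingular x₀ y₀) (h₈ : W.toAffine.Nonsingular x₀ y₈) (h₃ : W.toAffine.Nonsingular x₃ y₃)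
    (e₈ : (8 : ℕ) • (Affine.Point.some x₀ y₀ h₀ : W.toAffine.Point) = Affine.Point.some x₀ y₈ h₈)
    (hy₈ : y₈ = -y₀ - W.a₁ * x₀ - W.a₃)
    (e₃ : (3 : ℕ) • (Affine.Point.some x₀ y₀ h₀ : W.toAffine.Point) = Affine.Point.some x₃ y₃ h₃) :
    9 ∣ W.torsionOrder := by
  haveI : Fact (Nat.Prime 3) := ⟨Nat.prime_three⟩
  set P : W.toAffine.Point := Affine.Point.some x₀ y₀ h₀ with hP
  have key : ∀ {y₁ y₂ : ℚ} (h₁ : W.toAffine.Nonsingular x₀ y₁) (h₂ : W.toAffine.Nonsingular x₀ y₂), y₁ = y₂ →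
      (Affine.Point.some x₀ y₁ h₁ : W.toAffine.Point) = Affine.Point.some x₀ y₂ h₂ := by
    intro y₁ y₂ h₁ h₂ e; subst e; rfl
  have e₈' : (8 : ℕ) • P = -P := by
    rw [e₈, hP, Affine.Point.neg_some]
    exact key _ _ (by rw [hy₈]; rfl)
  have e₉ : (3 ^ (1 + 1) : ℕ) • P = 0 := by
    rw [show (3 ^ (1 + 1) : ℕ) = 8 + 1 from rfl, add_nsmul, one_nsmul, e₈', neg_add_cancel]
  have e₃' : ¬ (3 ^ 1 : ℕ) • P = 0 := by
    rw [pow_one, e₃]; exact Affine.Point.some_ne_zero _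
  have hord : addOrderOf P = 3 ^ (1 + 1) := addOrderOf_eq_prime_pow e₃' e₉
  have hfin : IsOfFinAddOrder P := addOrderOf_pos_iff.mp (by rw [hord]; norm_num)
  have h := addOrderOf_dvd_torsionOrder W hfin
  rwa [hord] at h

/-- **`9 ∣ #54b3(ℚ)_tors` — IN THE KERNEL**: `P = (-3, -5)` on `54b3 = [1, -1, 1, -14, 29]` has exact order `9`
(doublings with slopes `-2, 4, 1`: `2P = (9, 19)`, `4P = (3, 1)`, `8P = (-3, 7) = -P`; `3P = (1, -5)`).
[cite: Cremona2006, Table 1 (54b3)] [cite: SilvermanAEC2009, III.2.3] -/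
theorem nine_dvd_torsionOrder_54b3 : 9 ∣ (⟨1, -1, 1, -14, 29⟩ : WeierstrassCurve ℚ).torsionOrder := by
  haveI := isElliptic_54b3
  have h₀ : (⟨1, -1, 1, -14, 29⟩ : WeierstrassCurve ℚ).toAffine.Nonsingular (-3 : ℚ) (-5 : ℚ) :=
    WeierstrassCurve.Affine.equation_iff_nonsingular.mp ((WeierstrassCurve.Affine.equation_iff _ _).mpr (by norm_num))
  obtain ⟨h₈, e₈⟩ := nsmul_some_eq_of_ladderRunQ (W := (⟨1, -1, 1, -14, 29⟩ : WeierstrassCurve ℚ))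
    (xf := (-3 : ℚ)) (yf := (7 : ℚ)) h₀
    [⟨false, -2, 9, 19, 0, 0, 0⟩, ⟨false, 4, 3, 1, 0, 0, 0⟩, ⟨false, 1, -3, 7, 0, 0, 0⟩] (by decide +kernel)
  rw [show qScalar 1 _ = 8 from by decide] at e₈
  obtain ⟨h₃, e₃⟩ := nsmul_some_eq_of_ladderRunQ (W := (⟨1, -1, 1, -14, 29⟩ : WeierstrassCurve ℚ))
    (xf := (1 : ℚ)) (yf := (-5 : ℚ)) h₀ [⟨true, -2, 9, 19, 2, 1, -5⟩] (by decide +kernel)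
  rw [show qScalar 1 _ = 3 from by decide] at e₃
  exact nine_dvd_torsionOrder_of_multiples _ h₀ h₈ h₃ e₈ (by norm_num) e₃

/-- **`9 ∣ #1890r3(ℚ)_tors` — IN THE KERNEL**: `P = (117, -1109)` on `1890r3 = [1, -1, 1, 63058, -7866691]` has exact
order `9` (doublings with slopes `-50, 70, 34`: `2P = (2217, 103891)`, `4P = (537, 13171)`, `8P = (117, 991) = -P`;
`3P = (217, -4109)`). [cite: Cremona2006, Table 1 (1890r3)] [cite: SilvermanAEC2009, III.2.3] -/
theorem nine_dvd_torsionOrder_1890r3 : 9 ∣ (⟨1, -1, 1, 63058, -7866691⟩ : WeierstrassCurve ℚ).torsionOrder := by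
  haveI := isElliptic_1890r3
  have h₀ : (⟨1, -1, 1, 63058, -7866691⟩ : WeierstrassCurve ℚ).toAffine.Nonsingular (117 : ℚ) (-1109 : ℚ) :=
    WeierstrassCurve.Affine.equation_iff_nonsingular.mp ((WeierstrassCurve.Affine.equation_iff _ _).mpr (by norm_num))
  obtain ⟨h₈, e₈⟩ := nsmul_some_eq_of_ladderRunQ (W := (⟨1, -1, 1, 63058, -7866691⟩ : WeierstrassCurve ℚ))
    (xf := (117 : ℚ)) (yf := (991 : ℚ)) h₀
    [⟨false, -50, 2217, 103891, 0, 0, 0⟩, ⟨false, 70, 537, 13171, 0, 0, 0⟩, ⟨false, 34, 117, 991, 0, 0, 0⟩]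
    (by decide +kernel)
  rw [show qScalar 1 _ = 8 from by decide] at e₈
  obtain ⟨h₃, e₃⟩ := nsmul_some_eq_of_ladderRunQ (W := (⟨1, -1, 1, 63058, -7866691⟩ : WeierstrassCurve ℚ))
    (xf := (217 : ℚ)) (yf := (-4109 : ℚ)) h₀ [⟨true, -50, 2217, 103891, 50, 217, -4109⟩] (by decide +kernel)
  rw [show qScalar 1 _ = 3 from by decide] at e₃
  exact nine_dvd_torsionOrder_of_multiples _ h₀ h₈ h₃ e₈ (by norm_num) e₃

/-- **`9 ∣ #122094bl3(ℚ)_tors` — IN THE KERNEL**: `P = (8139, -16838)` on `122094bl3 = [1, -1, 1, -193010459,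
1031970436427]` has exact order `9` (doublings with slopes `-224, 280, 175`: `2P = (33675, 5703226)`,
`4P = (11331, 541762)`, `8P = (8139, 8698) = -P`; `3P = (8587, -92102)`). [cite: Cremona2006, Table 1 (122094bl3)]
[cite: SilvermanAEC2009, III.2.3] -/
theorem nine_dvd_torsionOrder_122094bl3 :
    9 ∣ (⟨1, -1, 1, -193010459, 1031970436427⟩ : WeierstrassCurve ℚ).torsionOrder := by
  haveI := isElliptic_122094bl3
  have h₀ : (⟨1, -1, 1, -193010459, 1031970436427⟩ : WeierstrassCurve ℚ).toAffine.Nonsingular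
      (8139 : ℚ) (-16838 : ℚ) :=
    WeierstrassCurve.Affine.equation_iff_nonsingular.mp ((WeierstrassCurve.Affine.equation_iff _ _).mpr (by norm_num))
  obtain ⟨h₈, e₈⟩ := nsmul_some_eq_of_ladderRunQ (W := (⟨1, -1, 1, -193010459, 1031970436427⟩ : WeierstrassCurve ℚ))
    (xf := (8139 : ℚ)) (yf := (8698 : ℚ)) h₀
    [⟨false, -224, 33675, 5703226, 0, 0, 0⟩, ⟨false, 280, 11331, 541762, 0, 0, 0⟩,
      ⟨false, 175, 8139, 8698, 0, 0, 0⟩] (by decide +kernel)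
  rw [show qScalar 1 _ = 8 from by decide] at e₈
  obtain ⟨h₃, e₃⟩ := nsmul_some_eq_of_ladderRunQ (W := (⟨1, -1, 1, -193010459, 1031970436427⟩ : WeierstrassCurve ℚ))
    (xf := (8587 : ℚ)) (yf := (-92102 : ℚ)) h₀ [⟨true, -224, 33675, 5703226, 224, 8587, -92102⟩]
    (by decide +kernel)
  rw [show qScalar 1 _ = 3 from by decide] at e₃
  exact nine_dvd_torsionOrder_of_multiples _ h₀ h₈ h₃ e₈ (by norm_num) e₃

/-! ## §2 The stub's `ℤ/9`-member hypothesis on the nine census curves -/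

/-- **Every one of the nine census curves satisfies the `ℤ/9`-member hypothesis of `Sig.stub_red_nineTorsionMember`
— IN THE KERNEL**: for `W` each literal member of `54b`, `1890r`, `122094bl` there is an elliptic `W'` with
`W ∼_ℚ W'` and `3² ∣ #W'(ℚ)_tors`, namely the class's `ℤ/9` member (§1) reached along the kernel isogenies of
`…NineTorsionIsogenies` / `isIsogenous_nine`. (The stub's other hypotheses — `r_an = 0`, `ClassO6 W 3`, reducibility —
are not asserted here.) [cite: Cremona2006, Table 1 (classes 54b, 1890r, 122094bl)] -/
theorem nineTorsionMember_census :
    (∀ W ∈ [(⟨1, -1, 1, 1, -1⟩ : WeierstrassCurve ℚ), ⟨1, -1, 1, -29, -53⟩, ⟨1, -1, 1, -14, 29⟩],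
      ∃ (W' : WeierstrassCurve ℚ) (_ : W'.IsElliptic), IsIsogenous W W' ∧ 3 ^ 2 ∣ W'.torsionOrder) ∧
    (∀ W ∈ [(⟨1, -1, 1, -24407, -1468369⟩ : WeierstrassCurve ℚ), ⟨1, -1, 1, -1979507, -1071477449⟩,
        ⟨1, -1, 1, 63058, -7866691⟩],
      ∃ (W' : WeierstrassCurve ℚ) (_ : W'.IsElliptic), IsIsogenous W W' ∧ 3 ^ 2 ∣ W'.torsionOrder) ∧
    (∀ W ∈ [(⟨1, -1, 1, -5862644, -3527169193⟩ : WeierstrassCurve ℚ), ⟨1, -1, 1, -426456524, -3389585226281⟩,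
        ⟨1, -1, 1, -193010459, 1031970436427⟩],
      ∃ (W' : WeierstrassCurve ℚ) (_ : W'.IsElliptic), IsIsogenous W W' ∧ 3 ^ 2 ∣ W'.torsionOrder) := by
  obtain ⟨h9a, h9b, h9c⟩ := isIsogenous_nine
  refine ⟨?_, ?_, ?_⟩
  · intro W hW
    simp only [List.mem_cons, List.not_mem_nil, or_false] at hW
    rcases hW with rfl | rfl | rfl
    · exact ⟨_, isElliptic_54b3, isIsogenous_54b1_54b3, nine_dvd_torsionOrder_54b3⟩
    · exact ⟨_, isElliptic_54b3, h9a, nine_dvd_torsionOrder_54b3⟩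
    · exact ⟨_, isElliptic_54b3, isIsogenous_self _, nine_dvd_torsionOrder_54b3⟩
  · intro W hW
    simp only [List.mem_cons, List.not_mem_nil, or_false] at hW
    rcases hW with rfl | rfl | rfl
    · exact ⟨_, isElliptic_1890r3, isIsogenous_1890r1_1890r3, nine_dvd_torsionOrder_1890r3⟩
    · exact ⟨_, isElliptic_1890r3, h9b, nine_dvd_torsionOrder_1890r3⟩
    · exact ⟨_, isElliptic_1890r3, isIsogenous_self _, nine_dvd_torsionOrder_1890r3⟩
  · intro W hW
    simp only [List.mem_cons, List.not_mem_nil, or_false] at hW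
    rcases hW with rfl | rfl | rfl
    · exact ⟨_, isElliptic_122094bl3, isIsogenous_122094bl1_122094bl3, nine_dvd_torsionOrder_122094bl3⟩
    · exact ⟨_, isElliptic_122094bl3, h9c, nine_dvd_torsionOrder_122094bl3⟩
    · exact ⟨_, isElliptic_122094bl3, isIsogenous_self _, nine_dvd_torsionOrder_122094bl3⟩

end Summit.BirchSwinnertonDyer.BirchSwinnertonDyer.Theorems.WildUpperReducibleNineTorsionWitnesses

end
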